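import Mathlib.Algebra.Polynomial.BigOperators
import Mathlib.Algebra.Polynomial.Roots
import Mathlib.Computability.Encoding
import Literature.Computability.AlgebraicComplexity.TauConjectureProofs
import Literature.Computability.Complexity.PolyAdviceClosure
import HarnessLib

/-!
# The Koiran–Tavenas transfer theorem: decomposition and assembly

Companion ("Proofs") file of `Literature.Computability.AlgebraicComplexity.TauConjecture` for the
named fact `Literature.Computability.AlgebraicComplexity.not_isPBounded_constantFreeComplexity_perPoly_of_realTauConjecture`
(Koiran 2011 / Tavenas 2014, Thm. 3.3: the real τ-conjecture implies that `τ(PER_n)` is not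
polynomially bounded), parallel to `TauConjectureProofs` (Bürgisser's transfer from the
Shub–Smale τ-conjecture), whose Pochhammer–Wilkinson polynomials and Bürgisser facts it reuses.

The printed proof (S. Tavenas, PhD thesis, ENS Lyon 2014, Ch. 3, §1.3, proof of Thm. 3.3, p. 47)
is a short assembly of three intermediate results. We vendor the two deep ones as named facts
(D-0014) with the thesis' numbering, PROVE the third from facts already in the tree, and PROVE
the assembly:

* Tavenas' notion of a family of integer polynomials **definable** in a Boolean class `K`
  (Déf. 3.11 and 3.12, univariate case; index `n` in unary, exponent `α` and bit position `j` in
  binary, sign folded into the bit encoding): `IsDefinableSeqIn K f`.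
* **Lemma 3.16** (named fact `Tavenas2014_pochhammerWilkinson_definable`): the family
  `PW_n = ∏_{i=1}^{2^n} (X - i)` (`pochhammerWilkinson (2 ^ n)`) is definable in `CH/poly`.
* **Proposition 3.21**, case `c = 1` of one variable, over `K = ℚ` (named fact
  `Tavenas2014_prop_3_21`): if `PER` has polynomial-size circuits, every family definable in
  `P/poly` of degree `< 2^d` and coefficients `< 2^{2^r}`, `r ≤ d = n^{O(1)}`, is a sum of
  `n^{O(√d)}` products of `O(√d)` many `n^{O(√d)}`-sparse polynomials.
* **Lemma 3.9** in Bürgisser's `τ`-form (`polyAdvice_CH_subset_PPoly_of`), PROVED from the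
  tree's Bürgisser facts (Lemma 2.12, `PP_subset_PPoly_of_isPBounded_perPoly`; Lemma 2.5(2),
  `CH_subset_PPoly_of_PP_subset_PPoly`), taken as hypotheses, and the proved closure
  `(P/poly)/poly ⊆ P/poly` (`polyAdvice_subset_PPoly`,
  `Literature.Computability.Complexity.PolyAdviceClosure`).
* PROVED assembly `not_isPBounded_constantFreeComplexity_perPoly_of_realTauConjecture_of`: the two
  facts (plus the two Bürgisser facts feeding Lemma 3.9) imply the target fact, following p. 47
  line by line: `PW_n` is definable in `P/poly`, hence a sum of `k ≤ n^{O(√n)}` products of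
  `m = O(√n)` polynomials with `t ≤ n^{O(√n)}` monomials over `ℚ ⊂ ℝ`; the real τ-conjecture bounds
  its `2^n` distinct real roots `1, …, 2^n` by `(k + m + t + 2)^c = 2^{O(√n log n)}`, absurd for
  `n = 4^j` large (`exists_pow_sqrt_lt_two_pow`).

The discharge `not_isPBounded_constantFreeComplexity_perPoly_of_realTauConjecture_holds` thus
reduces to discharging Lemma 3.16 (Bürgisser's Cor. 3.9/Thm. 3.7: iterated products in `CH`),
Prop. 3.21 (Prop. 3.17: Valiant's criterion Prop. 3.10 and `VNP`-completeness of `PER` over `ℚ`,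
Thm. 1.26; plus the depth-four reduction Thm. 2.16) and Bürgisser's Lemmas 2.12/2.5(2)
(`#P`-completeness of the permanent; closure of the levels `CₖP` under padding). None of these
is in Mathlib or the tree.

## Conventions

* `τ = constantFreeComplexity` (fan-in two, constants and sum coefficients in `{0, 1, -1}`), which
  is Tavenas' `τ` (Déf. 1.24: gates `+, -, ×`, constant `1`) up to a factor `≤ 3`; every
  statement here is invariant under constant factors on `τ`.
* "`n^{O(√d)}`" is rendered `≤ (n + 2) ^ (C * (Nat.sqrt d + 1))` and "`O(√d)`" as
  `≤ C * (Nat.sqrt d + 1)` with one constant `C` for all `n` (base `≥ 2` and the `+ 1` absorb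
  finitely many small `n`, the cases `d ∈ {0, 1}` and all `O`-constants; for a fixed family this
  is equivalent to the printed asymptotic form since every `f_n` has *some* such expression).
* `P/poly` is the tree's circuit class `PPoly` (`= polyAdvice P`, Arora–Barak Thm. 6.18, the
  tree's `PPoly_eq_polyAdvice_P`), as in the Bürgisser facts of `TauConjectureProofs`; `CH/poly`
  is `polyAdvice CH` (Tavenas Déf. 3.8 = Bürgisser Def. 2.4), as in `IsCHPolyDefinable`.
* Words: `(1^n # α, j)` is `boolPair (unary n) (boolPair (bin α) (bin j))` with Mathlib's
  `Computability.unaryEncodeNat` / `encodeNat` and the library pairing `boolPair`.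

## References

* S. Tavenas, *Bornes inférieures et supérieures dans les circuits arithmétiques*, PhD thesis,
  ENS Lyon 2014 (HAL tel-01066752), Ch. 3 §1: Conj. 3.2, Thm. 3.3 (p. 40), Déf. 3.8, Lemma 3.9,
  Prop. 3.10, Déf. 3.11–3.12, Lemma 3.16, Prop. 3.17, Prop. 3.21, proof of Thm. 3.3 (p. 47);
  Ch. 2, Thm. 2.16.
* P. Koiran, *Shallow circuits with high-powered inputs*, ICS 2011, 309–320, §6, Thm. 7.
* P. Bürgisser, *On defining integers and proving arithmetic circuit lower bounds*, Comput.
  Complexity 18 (2009) 81–103 (= ECCC TR06-113), Lemma 2.5, Lemma 2.12, Cor. 3.9.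
* S. Arora, B. Barak, *Computational Complexity* (2009), Def. 6.5, Def. 6.16, Thm. 6.18.
-/

noncomputable section

open Polynomial
open Literature.Computability.Complexity Computability

namespace Literature.Computability.AlgebraicComplexity

/-! ### Definable families of polynomials (Tavenas, Déf. 3.11 and 3.12) -/

/-- The sign-folded binary encoding of an integer `a` used in Tavenas' `Bit` languages
(thesis 2014, before Déf. 3.11: "le premier bit code le signe et les suivants, la valeur absolue"):
bit `0` is the sign (`true` iff `a < 0`), bit `j + 1` is bit `j` of `|a|`. [cite: Tavenas2014, Déf. 3.11] -/
def sbit (a : ℤ) : ℕ → Bool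
  | 0 => decide (a < 0)
  | j + 1 => a.natAbs.testBit j

/-- The query word `(1^n # α, j)` of Tavenas' `Bit(a)` language (thesis 2014, Déf. 3.11: `n` in
unary, `α` and `j` in binary): `⟨unary n, ⟨bin α, bin j⟩⟩` via the library pairing `boolPair`,
Mathlib's `unaryEncodeNat` and `encodeNat`. [cite: Tavenas2014, Déf. 3.11] -/
def encUQuery (n α j : ℕ) : List Bool :=
  boolPair (unaryEncodeNat n) (boolPair (encodeNat α) (encodeNat j))

/-- **A family of univariate integer polynomials definable in a class `K`** (Tavenas, thesis
2014, Déf. 3.11 and Déf. 3.12, case of one variable). Writing `f_n = ∑_α a(n, α) X^α`, the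
coefficient sequence `a(n, α) = coeff of X^α in f_n` must be *of exponential size* — there are
polynomials `p, q` with `a(n, α)` supported on `α < 2^{p(n)}` (i.e. `deg f_n < 2^{p(n)}`) and, for
`n ≥ 1` and `α < 2^{p(n)}`, of binary size below `2^{q(n)}` (rendered `|a(n, α)| < 2^{2^{q(n)}}`;
the printed "encoding of size `≤ 2^{q(n)}`" is the same up to `q ↦ q + 1`) — and the language
`Bit(a) = {(1^n # α, j) | the j-th bit of a(n, α) is 1}` (sign-folded bits `sbit`, words
`encUQuery`) must belong to `K`. As in the source, `a(n, α)` is only "defined" (constrained) for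
`α < 2^{p(n)}`. [cite: Tavenas2014, Déf. 3.12] -/
def IsDefinableSeqIn (K : Set (Language Bool)) (f : ℕ → Polynomial ℤ) : Prop :=
  ∃ p q : Polynomial ℕ,
    (∀ n, (f n).natDegree < 2 ^ p.eval n) ∧
    (∀ n α, 1 ≤ n → α < 2 ^ p.eval n → ((f n).coeff α).natAbs < 2 ^ 2 ^ q.eval n) ∧
    ∃ B ∈ K, ∀ n α j, α < 2 ^ p.eval n →
      (encUQuery n α j ∈ B ↔ sbit ((f n).coeff α) j = true)

/-- Definability is monotone in the class (immediate; used with `CH/poly ⊆ P/poly`). [cite: Tavenas2014, Déf. 3.12] -/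
theorem IsDefinableSeqIn.mono {K K' : Set (Language Bool)} (h : K ⊆ K') {f : ℕ → Polynomial ℤ}
    (hf : IsDefinableSeqIn K f) : IsDefinableSeqIn K' f := by
  obtain ⟨p, q, hp, hq, B, hB, hB'⟩ := hf
  exact ⟨p, q, hp, hq, B, h hB, hB'⟩

/-! ### The vendored intermediate results (named facts, D-0014) -/

/-- **Tavenas' Lemma 3.16** (thesis 2014, Lemma 3.16, case of `PW_n`; Bürgisser 2009, Cor. 3.9):
the family of Pochhammer–Wilkinson polynomials `PW_n = ∏_{i=1}^{2^n} (X - i)`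
(`pochhammerWilkinson (2 ^ n)`) is definable in `CH/poly` (`polyAdvice CH`) in the sense of
Déf. 3.12 (`IsDefinableSeqIn`). (The source adds that Bürgisser even proves definability in
`CH`; only the printed `CH/poly` form is recorded.) Named fact: the proof is Bürgisser's
Thm. 3.7 (iterated multiplication in the counting hierarchy via Dlogtime-uniform `TC⁰` Chinese
remaindering) through Thm. 3.13/3.15, none of it formalised. [cite: Tavenas2014, Lemma 3.16] -/
def Tavenas2014_pochhammerWilkinson_definable : Prop :=
  IsDefinableSeqIn (polyAdvice CH) fun n => pochhammerWilkinson (2 ^ n)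

/-- **Tavenas' Proposition 3.21**, case `c = 1` (one variable), over the field `K = ℚ`, with the
hypothesis "`Perm_n` admits circuits of size `n^{O(1)}`" strengthened to `τ(PER_n) = n^{O(1)}`
(constant-free circuits are circuits over `ℚ`; so this is WEAKER than print). Printed statement:
let `(f_n) ⊂ ℤ[X]` be definable in `P/poly`, of degree at most `2^d - 1` and with coefficients
of absolute value at most `2^{2^r} - 1`, where `r ≤ d = n^{O(1)}`; if `Perm_n` has circuits
`C_n` of size `n^{O(1)}` then `f_n` is computed by circuits `∑_{i=1}^{n^{O(√d)}} ∏_{j=1}^{O(√d)} f_{i,j}`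
with `n^{O(√d)}`-sparse polynomials `f_{i,j}` (over the fixed characteristic-zero field `K`,
§1.3). Rendering: `d, r : ℕ → ℕ` with `r ≤ d`, `d` p-bounded; sparsity = `support.card`; the
identity `f_n = ∑ ∏ f_{i,j}` in `ℚ[X]`; the `O`-terms with one constant `C` and base `n + 2` (see
the module docstring). Named fact: the proof is Prop. 3.17 (Valiant's criterion and the
`VNP`-completeness of the permanent give polynomial-size circuits for the multilinear polynomial
`h_n` with `f_n(X) = h_n(X^{2^0}, …, X^{2^{d-1}}, 2^{2^0}, …, 2^{2^{r-1}})`) followed by the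
depth-four reduction Thm. 2.16. [cite: Tavenas2014, Prop. 3.21] -/
def Tavenas2014_prop_3_21 : Prop :=
  IsPBounded (fun n => constantFreeComplexity (perPoly (Fin n) ℤ)) →
    ∀ (f : ℕ → Polynomial ℤ) (d r : ℕ → ℕ), IsPBounded d → (∀ n, r n ≤ d n) →
      IsDefinableSeqIn PPoly f →
      (∀ n, (f n).natDegree < 2 ^ d n) →
      (∀ n α, ((f n).coeff α).natAbs < 2 ^ 2 ^ r n) →
      ∃ C : ℕ, ∀ n, ∃ (k m t : ℕ) (g : Fin k → Fin m → Polynomial ℚ),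
        k ≤ (n + 2) ^ (C * (Nat.sqrt (d n) + 1)) ∧
        m ≤ C * (Nat.sqrt (d n) + 1) ∧
        t ≤ (n + 2) ^ (C * (Nat.sqrt (d n) + 1)) ∧
        (∀ i j, (g i j).support.card ≤ t) ∧
        (∑ i, ∏ j, g i j) = (f n).map (Int.castRingHom ℚ)

/-! ### Lemma 3.9: `τ(PER_n) = n^{O(1)}` collapses `CH/poly` to `P/poly` -/

/-- **Tavenas' Lemma 3.9 in Bürgisser's `τ`-form**: if `τ(PER_n)` is polynomially bounded then
`CH/poly ⊆ P/poly` — from Bürgisser's Lemma 2.12 (`τ(PER) = n^{O(1)} ⇒ PP ⊆ P/poly`, the tree's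
named fact `PP_subset_PPoly_of_isPBounded_perPoly`), Lemma 2.5(2) (`PP ⊆ P/poly ⇒ CH ⊆ P/poly`,
`CH_subset_PPoly_of_PP_subset_PPoly`) and `(P/poly)/poly ⊆ P/poly` (`polyAdvice_subset_PPoly`,
proved). The printed Lemma 3.9 has the (stronger) hypothesis `Perm_n ∈ VP⁰` and concludes
`CH/poly = P/poly`; the inclusion `P/poly ⊆ CH/poly` is not needed. (Tavenas 2014, Lemma 3.9,
"prouvé dans [21]" = Bürgisser 2009.) [cite: Tavenas2014, Lemma 3.9] -/
theorem polyAdvice_CH_subset_PPoly_of (h212 : PP_subset_PPoly_of_isPBounded_perPoly)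
    (h25 : CH_subset_PPoly_of_PP_subset_PPoly)
    (hτ : IsPBounded fun n => constantFreeComplexity (perPoly (Fin n) ℤ)) :
    polyAdvice CH ⊆ PPoly :=
  polyAdvice_subset_PPoly (h25 (h212 hτ))

/-! ### The Pochhammer–Wilkinson family `PW_n = ∏_{i=1}^{2^n} (X - i)`: the hypotheses of Prop. 3.21 -/

/-- Coefficient bound for a product of linear factors: every coefficient of `∏_{a ∈ s} (X - a)`
has absolute value at most `∏_{a ∈ s} (1 + |a|)` (induction on `s`; triangle inequality). [folklore] -/
theorem natAbs_coeff_prod_X_sub_C_le (s : Multiset ℤ) (k : ℕ) :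
    (((s.map fun a => X - C a).prod).coeff k).natAbs ≤ (s.map fun a => 1 + a.natAbs).prod := by
  induction s using Multiset.induction_on generalizing k with
  | empty =>
    simp only [Multiset.map_zero, Multiset.prod_zero, coeff_one]
    split_ifs <;> simp
  | cons a s ih =>
    simp only [Multiset.map_cons, Multiset.prod_cons]
    set P : Polynomial ℤ := (s.map fun a => X - C a).prod with hP
    have hcomm : (X - C a) * P = P * (X - C a) := mul_comm _ _
    rw [hcomm]
    cases k with
    | zero =>
      rw [mul_coeff_zero, Int.natAbs_mul]
      have h0 : ((X - C a : Polynomial ℤ).coeff 0).natAbs = a.natAbs := by simp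
      rw [h0]
      calc (P.coeff 0).natAbs * a.natAbs ≤ (s.map fun a => 1 + a.natAbs).prod * a.natAbs :=
            Nat.mul_le_mul_right _ (ih 0)
        _ ≤ (1 + a.natAbs) * (s.map fun a => 1 + a.natAbs).prod := by
            rw [mul_comm]; exact Nat.mul_le_mul_right _ (Nat.le_add_left _ _)
    | succ k =>
      rw [coeff_mul_X_sub_C]
      calc (P.coeff k - P.coeff (k + 1) * a).natAbs
          ≤ (P.coeff k).natAbs + (P.coeff (k + 1) * a).natAbs := Int.natAbs_sub_le _ _
        _ = (P.coeff k).natAbs + (P.coeff (k + 1)).natAbs * a.natAbs := by rw [Int.natAbs_mul]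
        _ ≤ (s.map fun a => 1 + a.natAbs).prod + (s.map fun a => 1 + a.natAbs).prod * a.natAbs :=
            Nat.add_le_add (ih k) (Nat.mul_le_mul_right _ (ih (k + 1)))
        _ = (1 + a.natAbs) * (s.map fun a => 1 + a.natAbs).prod := by ring

/-- The coefficients of `f_M = ∏_{k=1}^{M} (X - k)` are bounded by `(2M)^M` in absolute value
(each factor `1 + k ≤ 2M`). [folklore] -/
theorem natAbs_coeff_pochhammerWilkinson_le (M k : ℕ) :
    ((pochhammerWilkinson M).coeff k).natAbs ≤ (2 * M) ^ M := by
  refine (natAbs_coeff_prod_X_sub_C_le (pwRoots M) k).trans ?_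
  have h := Multiset.prod_le_pow_card ((pwRoots M).map fun a => 1 + a.natAbs) (2 * M) ?_
  · simpa using h
  · intro x hx
    obtain ⟨a, ha, rfl⟩ := Multiset.mem_map.1 hx
    obtain ⟨h1, h2⟩ := mem_pwRoots_iff.1 ha
    have : a.natAbs ≤ M := by
      have : (a.natAbs : ℤ) = a := Int.natAbs_of_nonneg (by omega)
      omega
    omega

/-- For `M = 2^n`: `|coeff (PW_n)| < 2^{2^{2n+3}}` (indeed `(2·2^n)^{2^n} = 2^{(n+1)2^n}` and
`(n+1) 2^n < 2^{2n+3}`), the coefficient hypothesis of Prop. 3.21 with `r = d = 2n + 3`. [folklore] -/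
theorem natAbs_coeff_pochhammerWilkinson_two_pow_lt (n k : ℕ) :
    ((pochhammerWilkinson (2 ^ n)).coeff k).natAbs < 2 ^ 2 ^ (2 * n + 3) := by
  refine (natAbs_coeff_pochhammerWilkinson_le _ _).trans_lt ?_
  have h1 : (2 * 2 ^ n) ^ 2 ^ n = 2 ^ ((n + 1) * 2 ^ n) := by
    rw [← pow_succ', ← pow_mul]
  rw [h1]
  refine Nat.pow_lt_pow_right (by norm_num) ?_
  have h2 : n + 1 < 2 ^ (n + 3) := by
    have := @Nat.lt_two_pow_self (n + 1)
    calc n + 1 < 2 ^ (n + 1) := this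
      _ ≤ 2 ^ (n + 3) := Nat.pow_le_pow_right (by norm_num) (by omega)
  calc (n + 1) * 2 ^ n < 2 ^ (n + 3) * 2 ^ n := Nat.mul_lt_mul_of_pos_right h2 (Nat.two_pow_pos n)
    _ = 2 ^ (2 * n + 3) := by rw [← pow_add]; ring_nf

/-- Degree hypothesis of Prop. 3.21 for `PW_n` with `d = 2n + 3`: `deg PW_n = 2^n < 2^{2n+3}`. [folklore] -/
theorem natDegree_pochhammerWilkinson_two_pow_lt (n : ℕ) :
    (pochhammerWilkinson (2 ^ n)).natDegree < 2 ^ (2 * n + 3) := by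
  rw [natDegree_pochhammerWilkinson]
  exact Nat.pow_lt_pow_right (by norm_num) (by omega)

/-- `PW` over `ℝ`: the image of `f_M` in `ℝ[X]` is `∏_{k=1}^{M} (X - k)`. [folklore] -/
theorem map_pochhammerWilkinson (M : ℕ) :
    (pochhammerWilkinson M).map (Int.castRingHom ℝ) =
      (((pwRoots M).map (Int.cast : ℤ → ℝ)).map fun a => X - C a).prod := by
  rw [pochhammerWilkinson, Polynomial.map_multiset_prod, Multiset.map_map, Multiset.map_map]
  congr 1
  refine Multiset.map_congr rfl fun a _ => ?_
  simp

/-- `f_M` has exactly `M` distinct real roots (namely `1, …, M`) ("Z_ℝ(PW) = 2^n", Tavenas 2014,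
proof of Thm. 3.3, p. 47). [cite: Tavenas2014, proof of Thm. 3.3] -/
theorem card_roots_toFinset_map_pochhammerWilkinson (M : ℕ) :
    ((pochhammerWilkinson M).map (Int.castRingHom ℝ)).roots.toFinset.card = M := by
  rw [map_pochhammerWilkinson, roots_multiset_prod_X_sub_C,
    Multiset.toFinset_card_of_nodup ((nodup_pwRoots M).map Int.cast_injective),
    Multiset.card_map, card_pwRoots]

/-- `f_M ≠ 0` in `ℝ[X]` (it is monic). [folklore] -/
theorem map_pochhammerWilkinson_ne_zero (M : ℕ) :
    (pochhammerWilkinson M).map (Int.castRingHom ℝ) ≠ 0 :=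
  ((monic_pochhammerWilkinson M).map _).ne_zero


/-! ### Growth lemma: `n^{O(√n)} = 2^{O(√n log n)}` is eventually below `2^n` -/

/-- For every constant `A` there is `n` (namely `n = 4^j`, `j` large) with
`(n + 2)^{A (⌊√(2n+3)⌋ + 4)} < 2^n`: quasi-polynomial growth `2^{O(√n log n)}` loses against `2^n`
("`2^{O(√n log n)}` … contredit `Z_ℝ(PW) = 2^n`", Tavenas 2014, proof of Thm. 3.3, p. 47). Proof:
for `n = 4^j`, `⌊√(2n+3)⌋ ≤ 2^{j+1}`, `n + 2 ≤ 2^{2j+1}`, so the left side is at most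
`2^{(2j+1) A 2^{j+2}}`, and `4 (2j+1) A < 2^j` for large `j` (`exists_add_two_pow_lt_two_pow`). [folklore] -/
theorem exists_pow_sqrt_lt_two_pow (A : ℕ) :
    ∃ n : ℕ, (n + 2) ^ (A * (Nat.sqrt (2 * n + 3) + 4)) < 2 ^ n := by
  obtain ⟨j, hj1, hj⟩ := exists_add_two_pow_lt_two_pow (8 * A + 1)
  -- `4 (2j+1) A < 2^j`
  have key : 4 * (2 * j + 1) * A < 2 ^ j := by
    have h1 : 8 * A ≤ (j + 2) ^ (8 * A) :=
      ((Nat.lt_two_pow_self).le).trans (Nat.pow_le_pow_left (by omega) _)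
    calc 4 * (2 * j + 1) * A ≤ (j + 2) * (8 * A) := by nlinarith
      _ ≤ (j + 2) * (j + 2) ^ (8 * A) := Nat.mul_le_mul_left _ h1
      _ = (j + 2) ^ (8 * A + 1) := (pow_succ' _ _).symm
      _ < 2 ^ j := hj
  refine ⟨4 ^ j, ?_⟩
  have h4 : 4 ^ j = 2 ^ j * 2 ^ j := by
    rw [show (4 : ℕ) = 2 * 2 from rfl, mul_pow]
  have hj4 : 4 ≤ 4 ^ j := by
    calc 4 = 4 ^ 1 := (pow_one 4).symm
      _ ≤ 4 ^ j := Nat.pow_le_pow_right (by norm_num) hj1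
  have h2j : 2 ≤ 2 ^ j := by
    calc 2 = 2 ^ 1 := (pow_one 2).symm
      _ ≤ 2 ^ j := Nat.pow_le_pow_right (by norm_num) hj1
  -- `⌊√(2·4^j+3)⌋ ≤ 2^{j+1}`
  have hs : Nat.sqrt (2 * 4 ^ j + 3) ≤ 2 ^ (j + 1) := by
    have hle : 2 * 4 ^ j + 3 ≤ (2 ^ (j + 1)) ^ 2 := by
      have : (2 ^ (j + 1)) ^ 2 = 4 * 4 ^ j := by
        rw [← pow_mul, show (j + 1) * 2 = 2 * j + 2 from by ring, pow_add, pow_mul,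
          show (2 : ℕ) ^ 2 = 4 from rfl]; ring
      rw [this]; omega
    calc Nat.sqrt (2 * 4 ^ j + 3) ≤ Nat.sqrt ((2 ^ (j + 1)) ^ 2) := Nat.sqrt_le_sqrt hle
      _ = 2 ^ (j + 1) := Nat.sqrt_eq' _
  -- exponent `≤ A · 2^{j+2}`
  have hE : A * (Nat.sqrt (2 * 4 ^ j + 3) + 4) ≤ A * 2 ^ (j + 2) := by
    refine Nat.mul_le_mul_left A ?_
    have : 2 ^ (j + 2) = 2 ^ (j + 1) + 2 ^ (j + 1) := by rw [pow_succ]; ring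
    have h4' : 4 ≤ 2 ^ (j + 1) := by rw [pow_succ]; omega
    omega
  -- base `≤ 2^{2j+1}`
  have hB : 4 ^ j + 2 ≤ 2 ^ (2 * j + 1) := by
    have : 2 ^ (2 * j + 1) = 2 * 4 ^ j := by rw [pow_succ, pow_mul]; norm_num; ring
    rw [this]; omega
  calc (4 ^ j + 2) ^ (A * (Nat.sqrt (2 * 4 ^ j + 3) + 4))
      ≤ (2 ^ (2 * j + 1)) ^ (A * (Nat.sqrt (2 * 4 ^ j + 3) + 4)) := Nat.pow_le_pow_left hB _
    _ ≤ (2 ^ (2 * j + 1)) ^ (A * 2 ^ (j + 2)) := Nat.pow_le_pow_right (Nat.two_pow_pos _) hE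
    _ = 2 ^ ((2 * j + 1) * (A * 2 ^ (j + 2))) := by rw [← pow_mul]
    _ < 2 ^ 4 ^ j := Nat.pow_lt_pow_right (by norm_num) ?_
  calc (2 * j + 1) * (A * 2 ^ (j + 2)) = 4 * (2 * j + 1) * A * 2 ^ j := by rw [pow_add]; ring
    _ < 2 ^ j * 2 ^ j := Nat.mul_lt_mul_of_pos_right key (Nat.two_pow_pos j)
    _ = 4 ^ j := h4.symm

/-! ### Assembly: proof of Tavenas' Thm. 3.3 from Lemma 3.9, Lemma 3.16 and Prop. 3.21 -/

/-- **Proof of Tavenas' Theorem 3.3** (thesis 2014, p. 47; Koiran 2011, §6), as an implication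
between named facts: Lemma 3.16 (`Tavenas2014_pochhammerWilkinson_definable`) and Prop. 3.21
(`Tavenas2014_prop_3_21`), together with Bürgisser's Lemma 2.12
(`PP_subset_PPoly_of_isPBounded_perPoly`) and Lemma 2.5(2) (`CH_subset_PPoly_of_PP_subset_PPoly`),
which yield Lemma 3.9 in the form `τ(PER_n) = n^{O(1)} ⇒ CH/poly ⊆ P/poly`, imply that the real
τ-conjecture forces `τ(PER_n)` not to be polynomially bounded. Printed argument: assuming
`τ(Perm_n) = n^{O(1)}`, `CH/poly = P/poly` (Lemma 3.9), so `PW_n = ∏_{i=1}^{2^n} (X - i)` is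
definable in `P/poly` (Lemma 3.16); by Prop. 3.21 (with `d = r = 2n + 3`: `deg PW_n = 2^n < 2^d`,
`|coeff| < 2^{2^d}`) it is a sum of `k ≤ n^{O(√n)}` products of `m = O(√n)` polynomials that are
`t ≤ n^{O(√n)}`-sparse, over `ℚ ⊂ ℝ`; the real τ-conjecture gives
`2^n = Z_ℝ(PW_n) ≤ (k + m + t + 2)^c = 2^{O(√n log n)}`, false for `n = 4^j` large
(`exists_pow_sqrt_lt_two_pow`). [cite: Tavenas2014, proof of Thm. 3.3] -/
theorem not_isPBounded_constantFreeComplexity_perPoly_of_realTauConjecture_of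
    (h316 : Tavenas2014_pochhammerWilkinson_definable) (h321 : Tavenas2014_prop_3_21)
    (h212 : PP_subset_PPoly_of_isPBounded_perPoly) (h25 : CH_subset_PPoly_of_PP_subset_PPoly) :
    not_isPBounded_constantFreeComplexity_perPoly_of_realTauConjecture := by
  intro hR hτ
  obtain ⟨c, hc⟩ := hR
  -- Lemma 3.9: `CH/poly ⊆ P/poly`
  have h39 : polyAdvice CH ⊆ PPoly := polyAdvice_CH_subset_PPoly_of h212 h25 hτ
  -- Lemma 3.16: `PW_n` is definable in `P/poly`
  have hdef : IsDefinableSeqIn PPoly (fun n => pochhammerWilkinson (2 ^ n)) := h316.mono h39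
  -- Prop. 3.21 with `d = r = 2n + 3`
  have hdP : IsPBounded (fun n => 2 * n + 3) :=
    (IsPBounded.iff_exists_le_mul_succ_pow _).2 ⟨3, 1, fun n => by rw [pow_one]; omega⟩
  obtain ⟨C, hC⟩ := h321 hτ (fun n => pochhammerWilkinson (2 ^ n)) (fun n => 2 * n + 3)
    (fun n => 2 * n + 3) hdP (fun n => le_rfl) hdef
    (fun n => natDegree_pochhammerWilkinson_two_pow_lt n)
    (fun n α => natAbs_coeff_pochhammerWilkinson_two_pow_lt n α)
  -- the bad `n`
  obtain ⟨n, hn⟩ := exists_pow_sqrt_lt_two_pow (c * (C + 1))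
  obtain ⟨k, m, t, g, hk, hm, ht, hg, hsum⟩ := hC n
  -- pass to `ℝ[X]`
  set G : Fin k → Fin m → Polynomial ℝ := fun i j => (g i j).map (algebraMap ℚ ℝ) with hG
  have hGsum : (∑ i, ∏ j, G i j) = (pochhammerWilkinson (2 ^ n)).map (Int.castRingHom ℝ) := by
    have h1 : (∑ i, ∏ j, G i j) = (∑ i, ∏ j, g i j).map (algebraMap ℚ ℝ) := by
      simp only [hG, Polynomial.map_sum, Polynomial.map_prod]
    rw [h1, hsum, Polynomial.map_map, RingHom.ext_int ((algebraMap ℚ ℝ).comp (Int.castRingHom ℚ))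
      (Int.castRingHom ℝ)]
  have hGt : ∀ i j, (G i j).support.card ≤ t := fun i j => by
    simp only [hG]
    rw [support_map_of_injective _ (algebraMap ℚ ℝ).injective]
    exact hg i j
  have hne : (∑ i, ∏ j, G i j) ≠ 0 := by
    rw [hGsum]; exact map_pochhammerWilkinson_ne_zero _
  -- the real τ-conjecture bound
  have hroots := hc k m t G hGt hne
  rw [hGsum, card_roots_toFinset_map_pochhammerWilkinson] at hroots
  -- `k + m + t + 2 ≤ (n + 2)^{E + 3}` with `E = C (⌊√d⌋ + 1)`
  set s : ℕ := Nat.sqrt (2 * n + 3) with hs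
  set E : ℕ := C * (s + 1) with hE
  have hB1 : 1 ≤ (n + 2) ^ E := Nat.one_le_pow _ _ (by omega)
  have hmE : m ≤ (n + 2) ^ E :=
    hm.trans ((Nat.lt_two_pow_self).le.trans (Nat.pow_le_pow_left (by omega) E))
  have hsumle : k + m + t + 2 ≤ (n + 2) ^ (E + 3) := by
    have h8 : 8 ≤ (n + 2) ^ 3 :=
      calc 8 = 2 ^ 3 := by norm_num
        _ ≤ (n + 2) ^ 3 := Nat.pow_le_pow_left (by omega) 3
    calc k + m + t + 2 ≤ 5 * (n + 2) ^ E := by omega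
      _ ≤ (n + 2) ^ 3 * (n + 2) ^ E := Nat.mul_le_mul_right _ (by omega)
      _ = (n + 2) ^ (E + 3) := by rw [← pow_add, Nat.add_comm 3 E]
  have hexp : c * (E + 3) ≤ c * (C + 1) * (s + 4) := by
    have : C * (s + 1) + 3 ≤ (C + 1) * (s + 4) := by nlinarith
    calc c * (E + 3) = c * (C * (s + 1) + 3) := by rw [hE]
      _ ≤ c * ((C + 1) * (s + 4)) := Nat.mul_le_mul_left c this
      _ = c * (C + 1) * (s + 4) := by ring
  have key : 2 ^ n ≤ (n + 2) ^ (c * (C + 1) * (s + 4)) :=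
    calc 2 ^ n ≤ (k + m + t + 2) ^ c := hroots
      _ ≤ ((n + 2) ^ (E + 3)) ^ c := Nat.pow_le_pow_left hsumle c
      _ = (n + 2) ^ (c * (E + 3)) := by rw [← pow_mul, mul_comm]
      _ ≤ (n + 2) ^ (c * (C + 1) * (s + 4)) := Nat.pow_le_pow_right (by omega) hexp
  exact absurd key (not_le.2 hn)

end Literature.Computability.AlgebraicComplexity
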